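import Summits.Ventures.CertifiedManyBodySolver.Downfold.WorkedExamplePassDomeReroute

/-!
# The §14 worked-example PASS criteria, part 7: GOLDEN SUCCESSION — a golden's expectation record splits into
# CONTENT keys (what the five §6 words read) and COUNT keys (certified-annex counts by kind per La-214 map and
# their aggregate); a COUNT-ONLY successor keeps every §6 word; ADD-ONLY hand-ins make the counts monotone, so a
# replay with a DECREASED certified count is not an add-only successor (the held erratum dir of 2026-08-30)

Venture CertifiedManyBodySolver, cell `pub/hubbard-downfold`, seat hubbard-downfold-score-2 (session g22, 2026-08-30);
namespace `Summit.Ventures.CertifiedManyBodySolver.Downfold.WorkedExample` (parts 1–6: `WorkedExamplePass`,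
`WorkedExamplePassDome`, `WorkedExamplePassDomeReroute`, `WorkedExamplePassItem8`, `WorkedExamplePassBandsOfRecord`,
`WorkedExamplePassWarningClasses`). Everything here is PROVED and finite; nothing is about a material.

The layer of record it mirrors: `validation/score/regression/v1/pin_golden.py` + `dry_replay.py` (hubbard-downfold-score-2).
A pinned GOLDEN `S<n>` is an expectation record over the nine §14 maps of one assembled `maps/run-*` dir. The replay of a
new dir against the latest golden classifies every differing key: COUNT-type = the certified-annex counts by kind on the
six La-214 maps (M13–M17, M50) and their aggregate (+ warning-class counts, part 6), CONTENT-type = router outcome, verdict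
kinds, PASS readings, rejected / hard lists. Policy (PREREG §E since S111): SEMANTIC-EQUAL ⇒ served by the latest golden,
no fixture; COUNT-only ⇒ register the printed differences in §E BEFORE the booking and pin AS PRINTED
(`--accept-count-differences`); a CONTENT key needs an expectation derived from the line of record. The goldens S149 … S158
of 2026-08-30 were all COUNT-only and every pin line says «§14 words UNCHANGED». This file is the kernel form of that sentence.

* §1 `KindCounts` (the six annex kinds the engines print), componentwise `add` / `ble`, `aggregate` over a list of maps;
  `Counts` = the six La-214 maps; `Counts.aggregate`. The live table has one shape (`la214 e o f`: energy-ordering `e`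
  on M13–M17 and `f` on M50, «other» `o` on M13, every other entry fixed along S148 … S158) and its aggregate is the closed form
  `⟨12, 5e + f, 38, 2, o + 37, 5⟩` (`aggregate_la214`) — e.g. S158: 5·1511 + 765 = 8320, 46 + 37 = 83 (`s158_aggregate`).
* §2 `Content` = exactly the arguments of the five §6 words (PASS-TV1 input, the six LSCO inputs + the 09-09 prerequisite
  bit + the dome members, the two controls) and `Content.words`; a `Golden` = content + counts; `pinCountOnly` = the
  successor the tool writes under `--accept-count-differences` (content copied, counts as printed). PROVED: its words are
  the predecessor's (`words_pinCountOnly`), and so are the words at the end of ANY chain of count-only pins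
  (`words_chain`) — «count-only ⇒ §14 words unchanged» for S148 → S158 whatever the content of record is
  (`words_liveChain`). Conversely a content mover CAN move a word: re-routing one LSCO input flips STAGE 1
  (`content_mover_moves_stage1`, part 3's La-214 re-route), which is why the tool refuses to write CONTENT keys as printed.
* §3 Hand-ins are ADD-ONLY (box END addenda; the assembler never deletes a certified row), so along honest successors every
  count is componentwise non-decreasing (`Counts.ble`); `ble` is reflexive and transitive (`ble_refl`, `ble_trans`), the live
  chain S148 ≤ S149 ≤ … ≤ S158 is add-only at every step with every step a genuine mover (`liveChain_addOnly`,
  `liveChain_movers`), and the dir of 2026-08-30T07:39Z whose replay printed Tc-upper-bound-K 12 → 8 on the aggregate is NOT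
  an add-only successor of S149 (`erratum_not_addOnly`) — the keeper HELD it un-numbered and the corrective cut (S150)
  is add-only over S149 (`s150_addOnly_over_s149`). A decreased certified count is thus a mechanical erratum flag, read
  before any booking.

WHAT THIS IS NOT: not a run verdict (deputy-2 books the RUN OF RECORD), not the regression suite itself, not a
certification of any annex row, no new number — the count triples below are the ones printed in PREREG §E / the pin lines.
-/

namespace Summit.Ventures.CertifiedManyBodySolver.Downfold

namespace WorkedExample

open CellScore

/-! ## §1 Certified-annex counts by kind, per map and aggregated -/

/-- The certified-annex counts of ONE map by kind, in the order the replay prints the aggregate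
(`Tc-upper-bound-K`, `energy-ordering`, `energy-window`, `order-ceiling`, `other`, `stiffness-ceiling`). [folklore] -/
structure KindCounts where
  /-- kind `Tc-upper-bound-K` -/
  tcUB : ℕ
  /-- kind `energy-ordering` -/
  eo : ℕ
  /-- kind `energy-window` -/
  ew : ℕ
  /-- kind `order-ceiling` -/
  oc : ℕ
  /-- kind `other` -/
  other : ℕ
  /-- kind `stiffness-ceiling` -/
  sc : ℕ
  deriving DecidableEq, Repr

namespace KindCounts

/-- no certified annex. [folklore] -/
def zero : KindCounts := ⟨0, 0, 0, 0, 0, 0⟩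

/-- kindwise sum of two maps' counts. [folklore] -/
def add (a b : KindCounts) : KindCounts :=
  ⟨a.tcUB + b.tcUB, a.eo + b.eo, a.ew + b.ew, a.oc + b.oc, a.other + b.other, a.sc + b.sc⟩

/-- componentwise `≤` (as a `Bool`, so that instances are `decide`d): `a` is dominated by `b` in every kind. [folklore] -/
def ble (a b : KindCounts) : Bool :=
  decide (a.tcUB ≤ b.tcUB) && decide (a.eo ≤ b.eo) && decide (a.ew ≤ b.ew) && decide (a.oc ≤ b.oc) &&
    decide (a.other ≤ b.other) && decide (a.sc ≤ b.sc)

/-- `ble` unfolded. [folklore] -/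
theorem ble_iff (a b : KindCounts) : a.ble b = true ↔
    a.tcUB ≤ b.tcUB ∧ a.eo ≤ b.eo ∧ a.ew ≤ b.ew ∧ a.oc ≤ b.oc ∧ a.other ≤ b.other ∧ a.sc ≤ b.sc := by
  simp [ble, Bool.and_eq_true, and_assoc]

/-- componentwise `≤` is reflexive. [folklore] -/
theorem ble_refl (a : KindCounts) : a.ble a = true := by
  simp [ble_iff]

/-- componentwise `≤` is transitive. [folklore] -/
theorem ble_trans {a b c : KindCounts} (h₁ : a.ble b = true) (h₂ : b.ble c = true) : a.ble c = true := by
  rw [ble_iff] at *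
  omega

/-- kindwise sums respect componentwise `≤` (the step behind «add-only map by map ⇒ add-only aggregate»). [folklore] -/
theorem add_ble_add {a b c d : KindCounts} (h₁ : a.ble b = true) (h₂ : c.ble d = true) :
    (a.add c).ble (b.add d) = true := by
  rw [ble_iff] at *
  simp only [add]
  omega

end KindCounts

/-- the AGGREGATE over a list of maps = kindwise sum («aggregate certified annexes on the nine»). [folklore] -/
def aggregate : List KindCounts → KindCounts
  | [] => KindCounts.zero
  | a :: tl => a.add (aggregate tl)

/-- the aggregate of no map. [folklore] -/
@[simp] theorem aggregate_nil : aggregate [] = KindCounts.zero := rfl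

/-- the aggregate, one map at a time. [folklore] -/
@[simp] theorem aggregate_cons (a : KindCounts) (tl : List KindCounts) :
    aggregate (a :: tl) = a.add (aggregate tl) := rfl

/-- The COUNT keys of a §14 golden: the certified-annex counts of the six La-214 maps (the three other maps of the
nine — H₃S, LK-99, Cu — carry no certified annex in any golden to date). [folklore] -/
structure Counts where
  /-- M13 La₂CuO₄ -/
  m13 : KindCounts
  /-- M14 LSCO x = 0.07 -/
  m14 : KindCounts
  /-- M15 LSCO x = 0.125 -/
  m15 : KindCounts
  /-- M16 LSCO x = 0.15 -/
  m16 : KindCounts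
  /-- M17 LSCO x = 0.22 -/
  m17 : KindCounts
  /-- M50 LSCO x = 0.30 -/
  m50 : KindCounts
  deriving DecidableEq, Repr

namespace Counts

/-- the six maps' counts as a list, in dome order. [folklore] -/
def toList (c : Counts) : List KindCounts := [c.m13, c.m14, c.m15, c.m16, c.m17, c.m50]

/-- the aggregate key of the golden. [folklore] -/
def aggregate (c : Counts) : KindCounts := WorkedExample.aggregate c.toList

/-- componentwise domination map by map (the ADD-ONLY successor relation on count keys). [folklore] -/
def ble (c d : Counts) : Bool :=
  c.m13.ble d.m13 && c.m14.ble d.m14 && c.m15.ble d.m15 && c.m16.ble d.m16 && c.m17.ble d.m17 && c.m50.ble d.m50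

/-- `ble` unfolded. [folklore] -/
theorem ble_iff (c d : Counts) : c.ble d = true ↔
    c.m13.ble d.m13 = true ∧ c.m14.ble d.m14 = true ∧ c.m15.ble d.m15 = true ∧ c.m16.ble d.m16 = true ∧
      c.m17.ble d.m17 = true ∧ c.m50.ble d.m50 = true := by
  simp [ble, Bool.and_eq_true, and_assoc]

/-- the add-only relation is reflexive. [folklore] -/
theorem ble_refl (c : Counts) : c.ble c = true := by
  simp [ble_iff, KindCounts.ble_refl]

/-- the add-only relation is transitive. [folklore] -/
theorem ble_trans {c d e : Counts} (h₁ : c.ble d = true) (h₂ : d.ble e = true) : c.ble e = true := by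
  rw [ble_iff] at *
  obtain ⟨a1, a2, a3, a4, a5, a6⟩ := h₁
  obtain ⟨b1, b2, b3, b4, b5, b6⟩ := h₂
  exact ⟨KindCounts.ble_trans a1 b1, KindCounts.ble_trans a2 b2, KindCounts.ble_trans a3 b3,
    KindCounts.ble_trans a4 b4, KindCounts.ble_trans a5 b5, KindCounts.ble_trans a6 b6⟩

/-- the aggregate key, spelled out over the six maps. [folklore] -/
theorem aggregate_eq (c : Counts) : c.aggregate =
    c.m13.add (c.m14.add (c.m15.add (c.m16.add (c.m17.add (c.m50.add KindCounts.zero))))) := rfl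

/-- an add-only successor dominates the aggregate too. [folklore] -/
theorem aggregate_ble_of_ble {c d : Counts} (h : c.ble d = true) : c.aggregate.ble d.aggregate = true := by
  rw [ble_iff] at h
  obtain ⟨a1, a2, a3, a4, a5, a6⟩ := h
  rw [aggregate_eq, aggregate_eq]
  exact KindCounts.add_ble_add a1 (KindCounts.add_ble_add a2 (KindCounts.add_ble_add a3
    (KindCounts.add_ble_add a4 (KindCounts.add_ble_add a5 (KindCounts.add_ble_add a6 (KindCounts.ble_refl _))))))

end Counts

/-- THE SHAPE OF THE LIVE TABLE along the 2026-08-30 chain S148 … S158: energy-ordering `e` on each of M13–M17 and `f` on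
M50, «other» `o` on M13; every other entry fixed (M14 other 6, M15 order-ceiling 2 / stiffness-ceiling 3 / other 14 / Tc-ub 5,
…) — the three moving counts are exactly the keys the ten registrations named. [folklore] -/
def la214 (e o f : ℕ) : Counts :=
  ⟨⟨2, e, 6, 0, o, 1⟩, ⟨1, e, 7, 0, 6, 0⟩, ⟨5, e, 7, 2, 14, 3⟩, ⟨1, e, 7, 0, 5, 0⟩, ⟨2, e, 6, 0, 8, 1⟩, ⟨1, f, 5, 0, 4, 0⟩⟩

/-- the aggregate of the live shape in closed form: `⟨12, 5e + f, 38, 2, o + 37, 5⟩`. [folklore] -/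
theorem aggregate_la214 (e o f : ℕ) : (la214 e o f).aggregate = ⟨12, 5 * e + f, 38, 2, o + 37, 5⟩ := by
  simp only [Counts.aggregate_eq, la214, KindCounts.add, KindCounts.zero, Nat.add_zero]
  congr 1
  omega

/-- within the live shape, add-only ⇔ the three moving counts do not decrease. [folklore] -/
theorem la214_ble_iff (e o f e' o' f' : ℕ) :
    (la214 e o f).ble (la214 e' o' f') = true ↔ e ≤ e' ∧ o ≤ o' ∧ f ≤ f' := by
  simp only [Counts.ble_iff, KindCounts.ble_iff, la214]
  omega

/-! ## §2 A golden = CONTENT keys + COUNT keys; the five §6 words read the content only -/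

/-- The CONTENT keys of a §14 golden: exactly the arguments of the five §6 words of parts 1–2 (PASS-TV1 on H₃S; the six
LSCO inputs for STAGE 1, the scorer's 09-09 prerequisite bit and the dome members for 09-09; the LK-99 and Cu controls). [folklore] -/
structure Content where
  /-- PASS-TV1 input (M08 H₃S) -/
  h3s : TV1
  /-- the six LSCO inputs (M13–M17, M50) -/
  six : Six
  /-- the 09-09 prerequisite bit as the scorer computes it -/
  pre : Bool
  /-- the dome members (bands of the four SC inputs) -/
  dome : Dome
  /-- PASS-TV3 control LK-99 (M30) -/
  lk99 : Control
  /-- PASS-TV3 control Cu (M32) -/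
  cu : Control

/-- the five §6 readings of a golden («§6 readings» of a replay). [folklore] -/
structure Words where
  /-- PASS-TV1 -/
  tv1 : Pass
  /-- PASS-TV2 STAGE 1 («today») -/
  tv2today : Pass
  /-- PASS-TV2 09-09 -/
  tv2later : Pass
  /-- PASS-TV3-LK99 -/
  tv3lk99 : Pass
  /-- PASS-TV3-Cu -/
  tv3cu : Pass
  deriving DecidableEq, Repr

/-- the five words, computed from the content keys and nothing else. [folklore] -/
def Content.words (c : Content) : Words :=
  ⟨tv1 c.h3s, stage1 c.six, stage2 c.pre c.six.kinds c.dome, tv3LK99 c.lk99, tv3Cu c.cu⟩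

/-- A pinned golden: suite id, RUN number of record (0 = candidate), content keys, count keys. [folklore] -/
structure Golden where
  /-- suite id (S148 ↦ 148) -/
  sid : ℕ
  /-- RUN # of record the dir was booked as -/
  run : ℕ
  /-- CONTENT-type keys -/
  content : Content
  /-- COUNT-type keys -/
  counts : Counts

/-- the §6 words of a golden. [folklore] -/
def Golden.words (g : Golden) : Words := g.content.words

/-- THE COUNT-ONLY PIN (`pin_golden.py … --accept-count-differences`): expectations = the predecessor's, with the count
keys written AS PRINTED by the replay; new suite id and RUN number. [folklore] -/
def pinCountOnly (g : Golden) (sid run : ℕ) (printed : Counts) : Golden := ⟨sid, run, g.content, printed⟩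

/-- a count-only pin copies the content keys. [folklore] -/
@[simp] theorem content_pinCountOnly (g : Golden) (sid run : ℕ) (printed : Counts) :
    (pinCountOnly g sid run printed).content = g.content := rfl

/-- a count-only pin carries the printed counts. [folklore] -/
@[simp] theorem counts_pinCountOnly (g : Golden) (sid run : ℕ) (printed : Counts) :
    (pinCountOnly g sid run printed).counts = printed := rfl

/-- COUNT-ONLY ⇒ §14 WORDS UNCHANGED: the successor reads the predecessor's five words. [folklore] -/
theorem words_pinCountOnly (g : Golden) (sid run : ℕ) (printed : Counts) :
    (pinCountOnly g sid run printed).words = g.words := rfl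

/-- one count-only mover as booked: (suite id, RUN #, printed counts). [folklore] -/
structure Mover where
  /-- suite id of the new golden -/
  sid : ℕ
  /-- RUN # of record -/
  run : ℕ
  /-- count keys as printed -/
  printed : Counts

/-- a chain of count-only pins applied to a base golden, oldest first. [folklore] -/
def chain (g : Golden) : List Mover → Golden
  | [] => g
  | m :: tl => chain (pinCountOnly g m.sid m.run m.printed) tl

/-- any chain of count-only pins keeps the content keys … [folklore] -/
theorem content_chain (g : Golden) (ms : List Mover) : (chain g ms).content = g.content := by
  induction ms generalizing g with
  | nil => rfl
  | cons m tl ih => exact ih _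

/-- … hence the five §6 words («§14 words UNCHANGED ALL SEAT», by induction on the pins). [folklore] -/
theorem words_chain (g : Golden) (ms : List Mover) : (chain g ms).words = g.words := by
  simp only [Golden.words, content_chain]

/-- … and ends on the last mover's printed counts (the live comparison base). [folklore] -/
theorem counts_chain_append (g : Golden) (ms : List Mover) (m : Mover) :
    (chain g (ms ++ [m])).counts = m.printed := by
  induction ms generalizing g with
  | nil => rfl
  | cons m' tl ih => exact ih _

/-- A CONTENT MOVER CAN MOVE A WORD (why CONTENT keys are never written as printed): on any content whose six LSCO inputs
pass STAGE 1, re-routing the six to PARTIAL (part 3's La-214 re-route of record) flips PASS-TV2-today to FAIL. [folklore] -/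
theorem content_mover_moves_stage1 (c : Content) (h : stage1 c.six = .PASS) :
    ({ c with six := c.six.mapRouter .PARTIAL } : Content).words.tv2today ≠ c.words.tv2today := by
  have h' : stage1 (c.six.mapRouter .PARTIAL) = .FAIL := stage1_mapRouter_ne c.six (by decide)
  simp only [Content.words, h, h']
  decide

/-! ## §3 The live chain S148 → S158 (2026-08-30): count-only, add-only, every step a mover; the held erratum dir -/

/-- S148 = RUN #369 (maps/run-2026-08-30v): eo 1090 / M13 other 36 / M50 eo 448. [folklore] -/
def s148 : Counts := la214 1090 36 448
/-- S149 = RUN #370 (30w): M13 other 37. [folklore] -/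
def s149 : Counts := la214 1090 37 448
/-- S150 = RUN #375 (30zc, the corrective cut): eo 1182, M13 other 39, M50 eo 536. [folklore] -/
def s150 : Counts := la214 1182 39 536
/-- S151 = RUN #377 (30ze): M50 eo 566. [folklore] -/
def s151 : Counts := la214 1182 39 566
/-- S152 = RUN #383 (30zk): M50 eo 765. [folklore] -/
def s152 : Counts := la214 1182 39 765
/-- S153 = RUN #384 (30zl): M13 other 40. [folklore] -/
def s153 : Counts := la214 1182 40 765
/-- S154 = RUN #386 (30zn): eo 1400. [folklore] -/
def s154 : Counts := la214 1400 40 765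
/-- S155 = RUN #387 (30zo): eo 1476. [folklore] -/
def s155 : Counts := la214 1476 40 765
/-- S156 = RUN #388 (30zp): eo 1511. [folklore] -/
def s156 : Counts := la214 1511 40 765
/-- S157 = RUN #389 (30zq): M13 other 42. [folklore] -/
def s157 : Counts := la214 1511 42 765
/-- S158 (30zr, RUN #390-candidate at filing): M13 other 46 (mod-4 g32's interlayer-profile-law instances). [folklore] -/
def s158 : Counts := la214 1511 46 765

/-- the S158 aggregate as printed: `{Tc-upper-bound-K 12, energy-ordering 8320, energy-window 38, order-ceiling 2,
other 83, stiffness-ceiling 5}` = the kindwise sum of the six maps. [folklore] -/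
theorem s158_aggregate : s158.aggregate = ⟨12, 8320, 38, 2, 83, 5⟩ := by decide

/-- the S157 aggregate as printed (other 79). [folklore] -/
theorem s157_aggregate : s157.aggregate = ⟨12, 8320, 38, 2, 79, 5⟩ := by decide

/-- the S148 aggregate as printed (energy-ordering 5898, other 73). [folklore] -/
theorem s148_aggregate : s148.aggregate = ⟨12, 5898, 38, 2, 73, 5⟩ := by decide

/-- the ten movers of 2026-08-30 after S148, oldest first (suite id, RUN #, printed counts; RUN 390 = the candidate
number of 30zr at filing). [folklore] -/
def liveMovers : List Mover :=
  [⟨149, 370, s149⟩, ⟨150, 375, s150⟩, ⟨151, 377, s151⟩, ⟨152, 383, s152⟩, ⟨153, 384, s153⟩, ⟨154, 386, s154⟩,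
    ⟨155, 387, s155⟩, ⟨156, 388, s156⟩, ⟨157, 389, s157⟩, ⟨158, 390, s158⟩]

/-- «COUNT-ONLY ⇒ §14 WORDS UNCHANGED» for the live chain: whatever the content of record of S148 is, S158 reads the same
five §6 words (WE-1 · WE-2 today / 09-09 · WE-3 ×2) and carries the 30zr counts. [folklore] -/
theorem words_liveChain (c : Content) (run : ℕ) :
    (chain ⟨148, run, c, s148⟩ liveMovers).words = c.words ∧ (chain ⟨148, run, c, s148⟩ liveMovers).counts = s158 :=
  ⟨words_chain _ _, rfl⟩

/-- consecutive count keys along the chain, as pairs (predecessor, successor). [folklore] -/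
def liveSteps : List (Counts × Counts) :=
  [(s148, s149), (s149, s150), (s150, s151), (s151, s152), (s152, s153), (s153, s154), (s154, s155), (s155, s156),
    (s156, s157), (s157, s158)]

/-- ADD-ONLY at every step: each successor dominates its predecessor map by map, kind by kind. [folklore] -/
theorem liveChain_addOnly : liveSteps.all (fun p => p.1.ble p.2) = true := by decide

/-- every step is a genuine MOVER (count keys differ — «SEMANTIC-EQUAL ⇒ no fixture» was never the case). [folklore] -/
theorem liveChain_movers : liveSteps.all (fun p => decide (p.1 ≠ p.2)) = true := by decide

/-- end to end: S148 ≤ S158 componentwise, and the aggregate «other» grew 73 → 83, energy-ordering 5898 → 8320. [folklore] -/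
theorem s148_ble_s158 : s148.ble s158 = true ∧ s148.aggregate.other = 73 ∧ s158.aggregate.other = 83 ∧
    s148.aggregate.eo = 5898 ∧ s158.aggregate.eo = 8320 := by decide

/-- THE HELD ERRATUM DIR (maps/run-2026-08-30zb, 07:39Z; dag-2 erratum «reader artefact», keeper HOLD): its replay vs S149
printed the AGGREGATE `Tc-upper-bound-K 12 → 8, other 74 → 76` — model the aggregate as printed. [folklore] -/
def erratumAggregate : KindCounts := ⟨8, 5898, 38, 2, 76, 5⟩

/-- a DECREASED certified count is not add-only: the erratum aggregate does not dominate S149's (12 > 8), although its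
«other» grew — so no add-only successor of S149 can have printed it (`Counts.aggregate_ble_of_ble`). [folklore] -/
theorem erratum_not_addOnly : s149.aggregate.ble erratumAggregate = false ∧
    ∀ d : Counts, s149.ble d = true → d.aggregate ≠ erratumAggregate := by
  refine ⟨by decide, fun d hd h => ?_⟩
  have := Counts.aggregate_ble_of_ble hd
  rw [h] at this
  exact absurd this (by decide)

/-- … while the corrective cut S150 (30zc) IS an add-only successor of S149 (eo 1090 → 1182, other 37 → 39, M50 eo
448 → 536), and the erratum dir never entered the chain. [folklore] -/
theorem s150_addOnly_over_s149 : s149.ble s150 = true ∧ s149.aggregate.ble s150.aggregate = true := by decide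

end WorkedExample

end Summit.Ventures.CertifiedManyBodySolver.Downfold
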